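import Summits.NavierStokesRegularity.NavierStokesRegularity.Theses.PeriodicPortability
import Literature.Analysis.FluidPDE.NSViscosityRescaling
import HarnessLib.Audit

/-!
# `BlowupPeriodises` is the route's own conditional target in costume

Crux-strategist r1 artefact for the crux `PeriodicPortability.BlowupPeriodises`
(item `stmt-NavierStokesRegularity-16203`, rank 2 of the CONDITIONAL BRIDGE route
`route-NavierStokesRegularity-PeriodicPortability`, conditional on printed Clay (B) = the item
`ClayB` = `Literature.Analysis.FluidPDE.NavierStokesExistenceSmoothPeriodic`).

The crux reads: for every `ν > 0` and every Clay datum `u₀` with NO Clay-(A) solution, SOME smooth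
divergence-free `ℤ³`-periodic `ψ` has no printed-(B) solution at `ν`. The witness `ψ` is not tied
to `u₀`. Consequently (all proofs below are sorry-free):

* `blowupPeriodises_iff_sliceBridge` — PURE LOGIC: the crux is literally the family of
  per-viscosity implications "(B) at `ν` ⇒ (A) at `ν`";
* `clayBAt_mono` — the viscosity scaling `v(s,x) = a·u(a s, x)`, `q = a²·p(a s, ·)` (Tao 2011,
  footnote 3; tree `NSViscosityRescaling`) makes "(B) at `ν`" independent of `ν`, whence
* `blowupPeriodises_iff_bridge` — **the crux is EQUIVALENT to `ClayB → NavierStokesRegularity`**,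
  i.e. to the route's deciding implication itself: the route "reduces (B) ⇒ (A) to (B) ⇒ (A)";
* `blowupPeriodises_of_summit` — the `S → C` probe succeeds by vacuity (the crux is a bare
  consequence of the summit), and `iff_summit_of_clayB` — under the declared condition the crux
  IS the summit.

No new mathematics; the point is the typing verdict (REDIRECT STRATEGIST r1, 2026-08-17).
-/

noncomputable section

open Set Function InnerProductSpace
open scoped ContDiff Laplacian
open Literature.Analysis.FluidPDE
open Summit.NavierStokesRegularity.NavierStokesRegularity.Theses.PeriodicPortability

namespace Summit.NavierStokesRegularity.NavierStokesRegularity.Cruxes.BlowupPeriodises.Costume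

set_option linter.unusedVariables false
set_option linter.dupNamespace false

local notation "ℝ³" => EuclideanSpace ℝ (Fin 3)

/-! ### The per-viscosity slices of Clay (A) and printed Clay (B) -/

/-- Clay (A) at one viscosity `ν`: every smooth divergence-free rapidly decaying datum on `ℝ³`
has a Clay-(A) solution of the unforced system with viscosity `ν`. [folklore] -/
def ClayAAt (ν : ℝ) : Prop :=
  ∀ u₀ : ℝ³ → ℝ³, ContDiff ℝ (⊤ : ℕ∞) u₀ → NSWave0.IsDivFree u₀ → HasRapidSpatialDecay u₀ →
    ∃ (u : ℝ → ℝ³ → ℝ³) (p : ℝ → ℝ³ → ℝ), IsSmoothOnHalfSpace u ∧ IsSmoothOnHalfSpace p ∧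
      IsNavierStokesSolution ν 0 u₀ u p ∧ HasBoundedEnergy u

/-- Printed Clay (B) at one viscosity `ν`: every smooth divergence-free `ℤ³`-periodic datum has a
jointly smooth solution `(v, q)` on `ℝ³ × [0,∞)` with `v(·,t)` periodic (pressure free, as
printed). [folklore] -/
def ClayBAt (ν : ℝ) : Prop :=
  ∀ ψ : ℝ³ → ℝ³, ContDiff ℝ (⊤ : ℕ∞) ψ → NSWave0.IsDivFree ψ → IsLatticePeriodic ψ →
    ∃ (v : ℝ → ℝ³ → ℝ³) (q : ℝ → ℝ³ → ℝ), IsSmoothOnHalfSpace v ∧ IsSmoothOnHalfSpace q ∧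
      IsNavierStokesSolution ν 0 ψ v q ∧ ∀ t, 0 ≤ t → IsLatticePeriodic (v t)

/-- The summit is the conjunction of its viscosity slices (definitional). [folklore] -/
theorem summit_iff_forall_clayAAt : NavierStokesRegularity ↔ ∀ ν : ℝ, 0 < ν → ClayAAt ν :=
  Iff.rfl

/-- The route's condition `ClayB` is the conjunction of its viscosity slices (definitional). [folklore] -/
theorem clayB_iff_forall_clayBAt : ClayB ↔ ∀ ν : ℝ, 0 < ν → ClayBAt ν :=
  Iff.rfl

/-- `ClayB` is verbatim the registered open conjecture (printed Clay (B)). [folklore] -/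
theorem clayB_iff_conjecture : ClayB ↔ NavierStokesExistenceSmoothPeriodic :=
  Iff.rfl

/-! ### Pure logic: the crux is the per-viscosity bridge (B)_ν ⇒ (A)_ν -/

/-- **Costume theorem, logical form.** `BlowupPeriodises` is, by pure (classical) logic, the
family of per-viscosity implications "printed Clay (B) at `ν` ⇒ Clay (A) at `ν`": the periodic
witness `ψ` of the crux is not tied to the whole-space datum `u₀`. [folklore] -/
theorem blowupPeriodises_iff_sliceBridge :
    BlowupPeriodises ↔ ∀ ν : ℝ, 0 < ν → (ClayBAt ν → ClayAAt ν) := by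
  constructor
  · intro hP ν hν hB u₀ hs hd hdec
    by_contra hno
    obtain ⟨ψ, hψs, hψd, hψp, hnone⟩ := hP ν hν u₀ hs hd hdec hno
    exact hnone (hB ψ hψs hψd hψp)
  · intro h ν hν u₀ hs hd hdec hno
    by_contra hall
    push Not at hall
    exact hno (h ν hν (fun ψ hψs hψd hψp => hall ψ hψs hψd hψp) u₀ hs hd hdec)

/-- **`S → C` holds by vacuity**: the summit makes the crux's antecedent false. So the crux is a
bare CONSEQUENCE of the summit (BC2 converse probe succeeds). [folklore] -/
theorem blowupPeriodises_of_summit (hS : NavierStokesRegularity) : BlowupPeriodises :=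
  fun ν hν u₀ hs hd hdec hno => absurd (hS ν hν u₀ hs hd hdec) hno

/-- The crux also follows from the FAILURE of printed (B) at every viscosity — it carries no
information about the whole-space datum. [folklore] -/
theorem blowupPeriodises_of_forall_not_clayBAt (h : ∀ ν : ℝ, 0 < ν → ¬ ClayBAt ν) :
    BlowupPeriodises :=
  blowupPeriodises_iff_sliceBridge.2 fun ν hν hB => absurd hB (h ν hν)

/-- Under the route's declared condition the crux IS the summit. [folklore] -/
theorem iff_summit_of_clayB (hB : ClayB) : BlowupPeriodises ↔ NavierStokesRegularity :=
  ⟨fun hP => closes hP hB, blowupPeriodises_of_summit⟩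

/-! ### Viscosity scaling of printed (B), and the sharp costume theorem -/

/-- `s ↦ a s` maps `[0,∞)` into itself for `a ≥ 0`. [folklore] -/
theorem mapsTo_mul_Ici {a : ℝ} (ha : 0 ≤ a) : MapsTo (fun s : ℝ => a * s) (Ici 0) (Ici 0) :=
  fun s hs => mul_nonneg ha hs

/-- **Time dilation of classical solutions on the half-space (Tao 2011, footnote 3).** If `(u, p)`
solves the unforced system with viscosity `ν` classically on `ℝ³ × [0,∞)`, then
`v(s, x) = a u(a s, x)`, `q(s, x) = a² p(a s, x)` (`a > 0`) solve it with viscosity `a ν`.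
(The tree's `IsClassicalNSSolutionOn.viscosityRescale_set` is the case `a = ν⁻¹`; same proof.) [cite: Tao2011, footnote 3] -/
theorem classical_timeDilation_Ici {ν a : ℝ} {u : ℝ → ℝ³ → ℝ³} {p : ℝ → ℝ³ → ℝ}
    (h : IsClassicalNSSolutionOn (Ici 0) ν 0 u p) (ha : 0 < a) :
    IsClassicalNSSolutionOn (Ici 0) (a * ν) 0 (timeRescale a a u) (timeRescale a (a ^ 2) p) where
  smooth_velocity := h.smooth_velocity.timeRescale _ _ (mapsTo_mul_Ici ha.le)
  smooth_pressure := h.smooth_pressure.timeRescale _ _ (mapsTo_mul_Ici ha.le)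
  momentum s hs x := by
    have hmaps := mapsTo_mul_Ici (a := a) ha.le
    have ht : a * s ∈ Ici (0 : ℝ) := hmaps hs
    set t : ℝ := a * s with htdef
    have hmom := h.momentum t ht x
    have hu2 : ContDiff ℝ 2 (u t) := (h.contDiff_velocity ht).of_le (by norm_cast)
    have hud : DifferentiableAt ℝ (u t) x := (hu2.differentiable (by norm_num)) x
    have hpd : DifferentiableAt ℝ (p t) x :=
      ((h.contDiff_pressure ht).differentiable (by simp)) x
    have hlap : (Δ fun y => a • u t y) x = a • (Δ (u t)) x := by
      rw [show (fun y => a • u t y) = a • u t from rfl]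
      exact laplacian_smul a hu2.contDiffAt
    rw [timeDerivWithin_timeRescale h.smooth_velocity a hmaps (uniqueDiffOn_Ici 0) hs x,
      timeRescale_slice, timeRescale_slice, convect_const_smul_const_smul hud, hlap,
      gradient_const_smul hpd, ← htdef, ← smul_add, hmom]
    simp only [Pi.zero_apply, add_zero, smul_sub, smul_smul]
    congr 1
    · rw [show a * a * ν = a * ν * a by ring]
    · rw [sq]
  divFree s hs := by
    rw [timeRescale_slice]
    have ht : a * s ∈ Ici (0 : ℝ) := mapsTo_mul_Ici ha.le hs
    exact (h.divFree _ ht).const_smul ((h.contDiff_velocity ht).differentiable (by simp)) _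

/-- **Printed Clay (B) does not depend on the viscosity** (scaling `ψ ↦ (ν/μ) ψ` of the datum and
time dilation by `a = μ/ν` of the solution; periodicity in `x` is untouched). [cite: Tao2011, footnote 3] -/
theorem clayBAt_mono {ν μ : ℝ} (hν : 0 < ν) (hμ : 0 < μ) (h : ClayBAt ν) : ClayBAt μ := by
  intro ψ hψs hψd hψp
  set c : ℝ := ν / μ with hc
  set a : ℝ := μ / ν with hadef
  have ha0 : 0 < a := div_pos hμ hν
  have hac : a * c = 1 := by
    rw [hadef, hc, div_mul_div_comm, mul_comm μ ν, div_self (mul_ne_zero hν.ne' hμ.ne')]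
  have haν : a * ν = μ := by rw [hadef, div_mul_cancel₀ μ hν.ne']
  have hψ's : ContDiff ℝ (⊤ : ℕ∞) (fun y => c • ψ y) := hψs.const_smul c
  have hψ'd : NSWave0.IsDivFree (fun y => c • ψ y) :=
    VectorCalculus.IsDivFree.const_smul (hψs.differentiable (by simp)) hψd c
  have hψ'p : IsLatticePeriodic (fun y => c • ψ y) := fun j y => by
    show c • ψ (y + EuclideanSpace.single j 1) = c • ψ y
    rw [hψp j y]
  obtain ⟨v, q, hv, hq, hsol, hper⟩ := h _ hψ's hψ'd hψ'p
  have hcl : IsClassicalNSSolutionOn (Ici 0) ν 0 v q :=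
    ⟨hv, hq, fun t ht x => hsol.momentum t ht x, fun t ht => hsol.divFree t ht⟩
  have hcl' : IsClassicalNSSolutionOn (Ici 0) μ 0 (timeRescale a a v) (timeRescale a (a ^ 2) q) :=
    haν ▸ classical_timeDilation_Ici hcl ha0
  refine ⟨timeRescale a a v, timeRescale a (a ^ 2) q, hcl'.smooth_velocity, hcl'.smooth_pressure,
    ⟨fun t ht x => hcl'.momentum t ht x, fun t ht => hcl'.divFree t ht, ?_⟩, ?_⟩
  · funext x
    simp only [timeRescale_apply, mul_zero, hsol.initial, smul_smul, hac, one_smul]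
  · intro t ht j y
    simp only [timeRescale_apply]
    rw [hper (a * t) (mul_nonneg ha0.le ht) j y]

/-- Printed (B) at one viscosity is printed (B) at all viscosities. [folklore] -/
theorem clayBAt_iff_clayB {ν : ℝ} (hν : 0 < ν) : ClayBAt ν ↔ ClayB :=
  ⟨fun h μ hμ => clayBAt_mono hν hμ h, fun h => h ν hν⟩

/-- **Costume theorem, sharp form.** The crux `BlowupPeriodises` is EQUIVALENT to the route's
deciding implication `ClayB → NavierStokesRegularity` ("printed Clay (B) implies Clay (A)"):
the route reduces "(B) ⇒ (A)" to itself. [folklore] -/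
theorem blowupPeriodises_iff_bridge : BlowupPeriodises ↔ (ClayB → NavierStokesRegularity) := by
  rw [blowupPeriodises_iff_sliceBridge]
  constructor
  · intro h hB ν hν
    exact h ν hν (hB ν hν)
  · intro h ν hν hBν
    exact h ((clayBAt_iff_clayB hν).1 hBν) ν hν

/-- The same with the registered conjecture name: the crux ⟺ (printed Clay (B) ⇒ Clay (A)). [folklore] -/
theorem blowupPeriodises_iff_conjecture_implies_summit :
    BlowupPeriodises ↔ (NavierStokesExistenceSmoothPeriodic → NavierStokesRegularity) :=
  blowupPeriodises_iff_bridge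

/-- Equivalently, at a single viscosity: the crux ⟺ ((B) at `ν = 1` ⇒ Clay (A)). [folklore] -/
theorem blowupPeriodises_iff_clayBAt_one_implies_summit :
    BlowupPeriodises ↔ (ClayBAt 1 → NavierStokesRegularity) := by
  rw [blowupPeriodises_iff_bridge, clayBAt_iff_clayB one_pos]

end Summit.NavierStokesRegularity.NavierStokesRegularity.Cruxes.BlowupPeriodises.Costume

end
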